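import Summits.QuantumFields.YangMills.Theorems.BalabanLadderNTConjugateResponse
import Mathlib.Analysis.Calculus.MeanValue
import Mathlib.Analysis.SpecialFunctions.Trigonometric.DerivHyp
import HarnessLib

/-!
# Crux `NT` / seam `UVSeamRec.stub_floorsEngine` (S-B), residual MF: the MEASURE SANDWICH — a δ-tilt moves bounded
# expectations by at most `K(e^{2δ}−1)`, and a sandwich of the coupling-modulated law gives the CONJUGATE RESPONSE
# (card `delta-sandwich-conjugate-response`, kernel-checked in the tree)

Helper file (`--supports stmt-QuantumFields-20043`; owner RULINGS R78/R87) of the fleet lead `ym-spine-19353-p1`,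
kernel-checking in the tree the generic layer of crux-ideate card 12 `delta-sandwich-conjugate-response`
(`ym-cruxidea-19353-2` g12/g13, HOME sketch `MeasureSandwich.lean` rev 2, rc 0) and composing it with the
conjugate-response currency `…NTConjugateResponse` (p540130).
WHICH CLAUSE IT SUPPLIES: the `hCR` hypothesis (unsigned conjugate response `c_R ≤ |Cov_T(Ṽ∘Θ₀, W)|`) of
`ConjugateResponse.mirrorFloor_of_abs_response` / `ConjugateResponseFloors.stubFloorsEngine_of_conjugateResponse_rF`
(p540929), hence MF(4ε) = the R87 residual of conjunct 2 (two-point floor) of the REGISTERED `UVSeamRec.stub_floorsEngine`.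

* §1 `exp_neg_le_integral_exp`, `integral_exp_le_exp` — the normaliser of a `δ`-bounded tilt lies in `[e^{−δ}, e^{δ}]`;
  **`abs_integral_tilted_sub_integral_le`** — for a probability measure `ν`, measurable `f` with `|f| ≤ δ` and
  measurable `W` with `|W| ≤ K`: `|∫ W d(ν.tilted f) − ∫ W dν| ≤ K·(e^{2δ} − 1)` (only the OSCILLATION of the
  log-density is paid for); `abs_cov_tilted_sub_cov_le` — the covariance form `≤ 3K_PK_W(e^{2δ}−1)`.
* §2 `abs_increment_sub_le`, `abs_deriv_ge_of_increment`, **`abs_deriv_ge_of_sandwich`** — an increment floor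
  `2Tm ≤ |b₊ − b₋|` for EXPLICIT values `b_±` with `|φ(±T) − b_±| ≤ ε` and a `κ`-Lipschitz derivative at `0` force
  `|φ'(0)| ≥ m − ε/T − κT`.
* §3 **`abs_cov_ge_of_sandwich`** — along Mathlib's tilted family `μₜ = μ.tilted (t·Z)` with the tree's tilt calculus
  `SkewResponse.hasDerivAt_integral_tilted`: {curvature ceiling (K3C)} + {sandwich outputs at `±T`} + {explicit
  increment (GC)} ⟹ `m − ε/T − κT ≤ |Cov_μ(W, Z)|`.
* §4 **`abs_mirrorCov_ge_of_sandwich`** — the torus composition with `Z = Ṽ∘Θ₀∘lift` (the coupling modulated on the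
  mirror cube): the conclusion is literally the `hCR` hypothesis of p540130/p540929.

HONEST FRAMING.  Generic measure theory / one-variable calculus and one composition; what the card asks an ENGINE
for — (MS) the conditional last-scale law is a `δ(γ)`-tilt of the explicit Gaussian-around-background law off a rare
set, (GC) the explicit free-field increment, (K3C) the curvature ceiling, (LF)/(BO) rarity and boundary oscillation —
is OPEN and not asserted here (barrier `PerturbativeInvisibility`).  Nothing about NT, the seam or a mass gap.
[cite: GlimmJaffe1987, §6.1]
-/

set_option autoImplicit false

noncomputable section

open MeasureTheory Filter Topology

namespace Summit.QuantumFields.YangMills.Cruxes.NT.MeasureSandwich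

variable {Ω : Type*} [MeasurableSpace Ω] {μ : Measure Ω}

/-! ## §1 The measure sandwich: a `δ`-tilt moves bounded expectations by at most `K(e^{2δ} − 1)` -/

section Sandwich

variable {f W : Ω → ℝ} {δ K : ℝ}

/-- `e^{f} ` is integrable for bounded measurable `f` on a finite measure space. [folklore] -/
theorem integrable_exp_of_bdd [IsFiniteMeasure μ] (hf : Measurable f) (hfb : ∀ ω, |f ω| ≤ δ) :
    Integrable (fun ω => Real.exp (f ω)) μ := by
  have h := SkewResponse.integrable_exp_mul (μ := μ) hf hfb 1
  simpa using h

/-- Lower normaliser bound `e^{−δ} ≤ ∫ e^{f} dν` for `|f| ≤ δ` and a probability measure. [folklore] -/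
theorem exp_neg_le_integral_exp [IsProbabilityMeasure μ] (hf : Measurable f) (hfb : ∀ ω, |f ω| ≤ δ) :
    Real.exp (-δ) ≤ ∫ ω, Real.exp (f ω) ∂μ := by
  calc Real.exp (-δ) = ∫ _ω, Real.exp (-δ) ∂μ := by simp
    _ ≤ ∫ ω, Real.exp (f ω) ∂μ :=
        integral_mono (integrable_const _) (integrable_exp_of_bdd hf hfb) fun ω => by
          have h := hfb ω
          rw [abs_le] at h
          exact Real.exp_le_exp.2 (by linarith [h.1])

/-- Upper normaliser bound `∫ e^{f} dν ≤ e^{δ}` for `|f| ≤ δ` and a probability measure. [folklore] -/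
theorem integral_exp_le_exp [IsProbabilityMeasure μ] (hf : Measurable f) (hfb : ∀ ω, |f ω| ≤ δ) :
    ∫ ω, Real.exp (f ω) ∂μ ≤ Real.exp δ := by
  calc ∫ ω, Real.exp (f ω) ∂μ ≤ ∫ _ω, Real.exp δ ∂μ :=
        integral_mono (integrable_exp_of_bdd hf hfb) (integrable_const _) fun ω =>
          Real.exp_le_exp.2 ((le_abs_self _).trans (hfb ω))
    _ = Real.exp δ := by simp

/-- **THE MEASURE SANDWICH.**  For a probability measure `ν`, a measurable log-density `f` with `|f| ≤ δ` and a bounded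
measurable observable `|W| ≤ K`:  `|∫ W d(ν.tilted f) − ∫ W dν| ≤ K (e^{2δ} − 1)`.  The density of `ν.tilted f` with
respect to `ν` is `e^{f}/∫e^{f}dν ∈ [e^{−2δ}, e^{2δ}]`, so `|density − 1| ≤ e^{2δ} − 1` pointwise; any CONSTANT added to `f`
cancels — only the oscillation of the log-density is paid for. [folklore] -/
theorem abs_integral_tilted_sub_integral_le [IsProbabilityMeasure μ] (hf : Measurable f) (hW : Measurable W)
    (hfb : ∀ ω, |f ω| ≤ δ) (hWb : ∀ ω, |W ω| ≤ K) :
    |(∫ ω, W ω ∂(μ.tilted f)) - ∫ ω, W ω ∂μ| ≤ K * (Real.exp (2 * δ) - 1) := by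
  rw [SkewResponse.integral_tilted_eq_div]
  set D := ∫ ω, Real.exp (f ω) ∂μ with hD
  have hDlo : Real.exp (-δ) ≤ D := exp_neg_le_integral_exp hf hfb
  have hDhi : D ≤ Real.exp δ := integral_exp_le_exp hf hfb
  have hDpos : 0 < D := lt_of_lt_of_le (Real.exp_pos _) hDlo
  have hWef : Integrable (fun ω => W ω * Real.exp (f ω)) μ := by
    have h := SkewResponse.integrable_mul_exp (μ := μ) hf hW hfb hWb 1
    simpa using h
  have hWint : Integrable W μ :=
    Integrable.of_bound hW.aestronglyMeasurable K
      (ae_of_all _ fun ω => by rw [Real.norm_eq_abs]; exact hWb ω)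
  have e : (∫ ω, W ω * Real.exp (f ω) ∂μ) / D - ∫ ω, W ω ∂μ =
      ∫ ω, W ω * (Real.exp (f ω) / D - 1) ∂μ := by
    have hp : ∀ ω, W ω * (Real.exp (f ω) / D - 1) = D⁻¹ * (W ω * Real.exp (f ω)) - W ω := fun ω => by
      rw [div_eq_mul_inv]; ring
    simp_rw [hp]
    rw [integral_sub (hWef.const_mul _) hWint, integral_const_mul, div_eq_inv_mul]
  rw [e]
  have hpt : ∀ ω, |W ω * (Real.exp (f ω) / D - 1)| ≤ K * (Real.exp (2 * δ) - 1) := by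
    intro ω
    rw [abs_mul]
    have hK : 0 ≤ K := (abs_nonneg _).trans (hWb ω)
    refine mul_le_mul (hWb ω) ?_ (abs_nonneg _) hK
    have hfω := hfb ω
    rw [abs_le] at hfω
    have hlo : Real.exp (-(2 * δ)) ≤ Real.exp (f ω) / D := by
      rw [le_div_iff₀ hDpos]
      calc Real.exp (-(2 * δ)) * D ≤ Real.exp (-(2 * δ)) * Real.exp δ :=
            mul_le_mul_of_nonneg_left hDhi (Real.exp_nonneg _)
        _ = Real.exp (-δ) := by rw [← Real.exp_add]; ring_nf
        _ ≤ Real.exp (f ω) := Real.exp_le_exp.2 (by linarith [hfω.1])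
    have hhi : Real.exp (f ω) / D ≤ Real.exp (2 * δ) := by
      rw [div_le_iff₀ hDpos]
      calc Real.exp (f ω) ≤ Real.exp δ := Real.exp_le_exp.2 hfω.2
        _ = Real.exp (2 * δ) * Real.exp (-δ) := by rw [← Real.exp_add]; ring_nf
        _ ≤ Real.exp (2 * δ) * D := mul_le_mul_of_nonneg_left hDlo (Real.exp_nonneg _)
    have h2 : 2 ≤ Real.exp (2 * δ) + Real.exp (-(2 * δ)) := by
      have hc := Real.one_le_cosh (2 * δ)
      rw [Real.cosh_eq] at hc
      linarith
    rw [abs_le]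
    constructor <;> linarith
  calc |∫ ω, W ω * (Real.exp (f ω) / D - 1) ∂μ| ≤ ∫ ω, |W ω * (Real.exp (f ω) / D - 1)| ∂μ :=
        abs_integral_le_integral_abs
    _ ≤ ∫ _ω, K * (Real.exp (2 * δ) - 1) ∂μ :=
        integral_mono_of_nonneg (ae_of_all _ fun ω => abs_nonneg _) (integrable_const _) (ae_of_all _ hpt)
    _ = K * (Real.exp (2 * δ) - 1) := by simp

/-- **COVARIANCE FORM of the sandwich** (the zeroth-order discharge of the sibling card's (H2)+(H3)): for two bounded
measurable observables `|P| ≤ K_P`, `|W| ≤ K_W` and a `δ`-tilt, the covariances differ by at most `3 K_P K_W (e^{2δ} − 1)`.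
(Apply it to the CENTRED small-field versions of `P`, `W`, whose bounds are `O(γ²p(γ)²)`, to keep the error below the
`O(γ⁴)` explicit signal.) [folklore] -/
theorem abs_cov_tilted_sub_cov_le [IsProbabilityMeasure μ] {P : Ω → ℝ} {KP : ℝ} (hf : Measurable f)
    (hP : Measurable P) (hW : Measurable W) (hfb : ∀ ω, |f ω| ≤ δ) (hPb : ∀ ω, |P ω| ≤ KP) (hWb : ∀ ω, |W ω| ≤ K) :
    |((∫ ω, P ω * W ω ∂(μ.tilted f)) - (∫ ω, P ω ∂(μ.tilted f)) * (∫ ω, W ω ∂(μ.tilted f))) -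
        ((∫ ω, P ω * W ω ∂μ) - (∫ ω, P ω ∂μ) * (∫ ω, W ω ∂μ))| ≤ 3 * (KP * K) * (Real.exp (2 * δ) - 1) := by
  have hPWb : ∀ ω, |P ω * W ω| ≤ KP * K := fun ω => by
    rw [abs_mul]; exact mul_le_mul (hPb ω) (hWb ω) (abs_nonneg _) ((abs_nonneg _).trans (hPb ω))
  have h1 := abs_integral_tilted_sub_integral_le (μ := μ) hf (hP.mul hW) hfb hPWb
  have h2 := abs_integral_tilted_sub_integral_le (μ := μ) hf hP hfb hPb
  have h3 := abs_integral_tilted_sub_integral_le (μ := μ) hf hW hfb hWb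
  -- bounds on the plain expectations
  haveI : IsProbabilityMeasure (μ.tilted f) := isProbabilityMeasure_tilted (integrable_exp_of_bdd hf hfb)
  have hPμ : |∫ ω, P ω ∂μ| ≤ KP := by
    calc |∫ ω, P ω ∂μ| ≤ ∫ ω, |P ω| ∂μ := abs_integral_le_integral_abs
      _ ≤ ∫ _ω, KP ∂μ := integral_mono_of_nonneg (ae_of_all _ fun ω => abs_nonneg _) (integrable_const _)
          (ae_of_all _ hPb)
      _ = KP := by simp
  have hWt : |∫ ω, W ω ∂(μ.tilted f)| ≤ K := by
    calc |∫ ω, W ω ∂(μ.tilted f)| ≤ ∫ ω, |W ω| ∂(μ.tilted f) := abs_integral_le_integral_abs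
      _ ≤ ∫ _ω, K ∂(μ.tilted f) := integral_mono_of_nonneg (ae_of_all _ fun ω => abs_nonneg _)
          (integrable_const _) (ae_of_all _ hWb)
      _ = K := by simp
  -- product term: a'b' − ab = (a' − a) b' + a (b' − b)
  set a := ∫ ω, P ω ∂μ
  set a' := ∫ ω, P ω ∂(μ.tilted f)
  set b := ∫ ω, W ω ∂μ
  set b' := ∫ ω, W ω ∂(μ.tilted f)
  have hprod : |a' * b' - a * b| ≤ 2 * (KP * K) * (Real.exp (2 * δ) - 1) := by
    have e : a' * b' - a * b = (a' - a) * b' + a * (b' - b) := by ring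
    rw [e]
    calc |(a' - a) * b' + a * (b' - b)| ≤ |a' - a| * |b'| + |a| * |b' - b| := by
          have := abs_add_le ((a' - a) * b') (a * (b' - b))
          rwa [abs_mul, abs_mul] at this
      _ ≤ KP * (Real.exp (2 * δ) - 1) * K + KP * (K * (Real.exp (2 * δ) - 1)) :=
          add_le_add (mul_le_mul h2 hWt (abs_nonneg _) ((abs_nonneg _).trans h2))
            (mul_le_mul hPμ h3 (abs_nonneg _) ((abs_nonneg _).trans hPμ))
      _ = 2 * (KP * K) * (Real.exp (2 * δ) - 1) := by ring
  calc |(∫ ω, P ω * W ω ∂(μ.tilted f)) - a' * b' - ((∫ ω, P ω * W ω ∂μ) - a * b)|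
      = |((∫ ω, P ω * W ω ∂(μ.tilted f)) - ∫ ω, P ω * W ω ∂μ) - (a' * b' - a * b)| := by ring_nf
    _ ≤ |(∫ ω, P ω * W ω ∂(μ.tilted f)) - ∫ ω, P ω * W ω ∂μ| + |a' * b' - a * b| := abs_sub _ _
    _ ≤ KP * K * (Real.exp (2 * δ) - 1) + 2 * (KP * K) * (Real.exp (2 * δ) - 1) := add_le_add h1 hprod
    _ = 3 * (KP * K) * (Real.exp (2 * δ) - 1) := by ring

end Sandwich

/-! ## §2 A derivative floor from an increment floor and a curvature ceiling -/

section Increment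

/-- If `φ` is differentiable on `[−T, T]` with derivative `φ'`, and `φ'` is `κ`-Lipschitz at `0` there, then the
symmetric increment is `2Tφ'(0)` up to `2κT²` (mean value theorem on `[0,T]` and on `[−T,0]`). [folklore] -/
theorem abs_increment_sub_le {φ φ' : ℝ → ℝ} {T κ : ℝ} (hT : 0 < T) (hκ : 0 ≤ κ)
    (hφ : ∀ t ∈ Set.Icc (-T) T, HasDerivAt φ (φ' t) t)
    (hlip : ∀ t ∈ Set.Icc (-T) T, |φ' t - φ' 0| ≤ κ * |t|) :
    |φ T - φ (-T) - 2 * T * φ' 0| ≤ 2 * κ * T ^ 2 := by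
  have hcont : ∀ a b : ℝ, -T ≤ a → b ≤ T → ContinuousOn φ (Set.Icc a b) := fun a b ha hb t ht =>
    (hφ t ⟨ha.trans ht.1, ht.2.trans hb⟩).continuousAt.continuousWithinAt
  obtain ⟨ξ₁, hξ₁, h₁⟩ := exists_hasDerivAt_eq_slope φ φ' hT (hcont 0 T (by linarith) le_rfl)
    (fun t ht => hφ t ⟨by linarith [ht.1], ht.2.le⟩)
  have hT' : -T < 0 := by linarith
  obtain ⟨ξ₂, hξ₂, h₂⟩ := exists_hasDerivAt_eq_slope φ φ' hT' (hcont (-T) 0 le_rfl hT.le)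
    (fun t ht => hφ t ⟨ht.1.le, by linarith [ht.2]⟩)
  have hTne : T ≠ 0 := ne_of_gt hT
  have e₁ : φ T - φ 0 = T * φ' ξ₁ := by
    rw [h₁, sub_zero]; field_simp
  have e₂ : φ 0 - φ (-T) = T * φ' ξ₂ := by
    rw [h₂]
    have h0 : (0 : ℝ) - -T = T := by ring
    rw [h0]; field_simp
  have l₁ := hlip ξ₁ ⟨by linarith [hξ₁.1], hξ₁.2.le⟩
  have l₂ := hlip ξ₂ ⟨hξ₂.1.le, by linarith [hξ₂.2]⟩
  have a₁ : |ξ₁| ≤ T := abs_le.2 ⟨by linarith [hξ₁.1], hξ₁.2.le⟩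
  have a₂ : |ξ₂| ≤ T := abs_le.2 ⟨hξ₂.1.le, by linarith [hξ₂.2]⟩
  have key : φ T - φ (-T) - 2 * T * φ' 0 = T * ((φ' ξ₁ - φ' 0) + (φ' ξ₂ - φ' 0)) := by
    linear_combination e₁ + e₂
  rw [key, abs_mul, abs_of_pos hT]
  calc T * |(φ' ξ₁ - φ' 0) + (φ' ξ₂ - φ' 0)| ≤ T * (κ * |ξ₁| + κ * |ξ₂|) :=
        mul_le_mul_of_nonneg_left ((abs_add_le _ _).trans (add_le_add l₁ l₂)) hT.le
    _ ≤ T * (κ * T + κ * T) := by gcongr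
    _ = 2 * κ * T ^ 2 := by ring

/-- **Derivative floor from an increment floor**: `2Tm ≤ |φ(T) − φ(−T)|` and the hypotheses of
`abs_increment_sub_le` give `|φ'(0)| ≥ m − κT`. [folklore] -/
theorem abs_deriv_ge_of_increment {φ φ' : ℝ → ℝ} {T κ m : ℝ} (hT : 0 < T) (hκ : 0 ≤ κ)
    (hφ : ∀ t ∈ Set.Icc (-T) T, HasDerivAt φ (φ' t) t)
    (hlip : ∀ t ∈ Set.Icc (-T) T, |φ' t - φ' 0| ≤ κ * |t|)
    (hinc : 2 * T * m ≤ |φ T - φ (-T)|) : m - κ * T ≤ |φ' 0| := by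
  have h := abs_increment_sub_le hT hκ hφ hlip
  have h2 : |φ T - φ (-T)| ≤ 2 * T * |φ' 0| + 2 * κ * T ^ 2 := by
    have h3 := abs_sub_abs_le_abs_sub (φ T - φ (-T)) (2 * T * φ' 0)
    rw [abs_mul, abs_of_pos (by positivity : (0:ℝ) < 2 * T)] at h3
    linarith
  have h4 : 2 * T * m ≤ 2 * T * (|φ' 0| + κ * T) := by nlinarith
  have h5 := le_of_mul_le_mul_left h4 (by positivity : (0:ℝ) < 2 * T)
  linarith

/-- **Derivative floor from a SANDWICH**: if the true values `φ(±T)` are within `ε` of EXPLICIT values `b_±` whose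
increment is floored, `2Tm ≤ |b₊ − b₋|`, then `|φ'(0)| ≥ m − ε/T − κT`. [folklore] -/
theorem abs_deriv_ge_of_sandwich {φ φ' : ℝ → ℝ} {T κ m ε bp bm : ℝ} (hT : 0 < T) (hκ : 0 ≤ κ)
    (hφ : ∀ t ∈ Set.Icc (-T) T, HasDerivAt φ (φ' t) t)
    (hlip : ∀ t ∈ Set.Icc (-T) T, |φ' t - φ' 0| ≤ κ * |t|)
    (hp : |φ T - bp| ≤ ε) (hm : |φ (-T) - bm| ≤ ε) (hgc : 2 * T * m ≤ |bp - bm|) :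
    m - ε / T - κ * T ≤ |φ' 0| := by
  have hinc : 2 * T * (m - ε / T) ≤ |φ T - φ (-T)| := by
    have h1 : |bp - bm| ≤ |φ T - φ (-T)| + 2 * ε := by
      calc |bp - bm| = |(bp - φ T) + (φ T - φ (-T)) + (φ (-T) - bm)| := by ring_nf
        _ ≤ |bp - φ T| + |φ T - φ (-T)| + |φ (-T) - bm| := abs_add_three _ _ _
        _ ≤ ε + |φ T - φ (-T)| + ε := by rw [abs_sub_comm bp]; gcongr
        _ = |φ T - φ (-T)| + 2 * ε := by ring
    have e : 2 * T * (m - ε / T) = 2 * T * m - 2 * ε := by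
      field_simp
    linarith
  have h := abs_deriv_ge_of_increment hT hκ hφ hlip hinc
  linarith

end Increment

/-! ## §3 The response floor along Mathlib's tilted family (tree tilt calculus) -/

section Response

variable {Z W : Ω → ℝ} {MZ MW : ℝ}

/-- **RESPONSE FLOOR FROM A SANDWICH** (the card's composition, generic layer).  On a probability space, along
`μₜ = μ.tilted (t·Z)` with bounded measurable `Z, W`:
* (K3C) the curvature ceiling — the tilted covariance `Covₜ(W, Z)` is `κ`-Lipschitz at `t = 0` on `[−T, T]`
  (by the tree's `SkewResponse.hasDerivAt_cov_tilted` this is a ceiling `κ` on the third cumulant `κ₃,ₜ(W, Z, Z)`);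
* (MS)+(LF)+(BO) delivered as: the tilted expectations `E_{±T}[W]` are within `ε` of EXPLICIT numbers `b_±`;
* (GC) the explicit increment floor `2Tm ≤ |b₊ − b₋|`;
then `m − ε/T − κT ≤ |E[WZ] − E[W]E[Z]| = |Cov_μ(W, Z)|` — the `hCR` hypothesis of the RPCS press-buttons of record.
[folklore] -/
theorem abs_cov_ge_of_sandwich [IsProbabilityMeasure μ] (hZ : Measurable Z) (hW : Measurable W)
    (hZb : ∀ ω, |Z ω| ≤ MZ) (hWb : ∀ ω, |W ω| ≤ MW) {T κ m ε bp bm : ℝ} (hT : 0 < T) (hκ : 0 ≤ κ)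
    (hK3C : ∀ t ∈ Set.Icc (-T) T,
      |((∫ ω, W ω * Z ω ∂(μ.tilted fun ω => t * Z ω)) -
          (∫ ω, W ω ∂(μ.tilted fun ω => t * Z ω)) * (∫ ω, Z ω ∂(μ.tilted fun ω => t * Z ω))) -
        ((∫ ω, W ω * Z ω ∂μ) - (∫ ω, W ω ∂μ) * (∫ ω, Z ω ∂μ))| ≤ κ * |t|)
    (hp : |(∫ ω, W ω ∂(μ.tilted fun ω => T * Z ω)) - bp| ≤ ε)
    (hm : |(∫ ω, W ω ∂(μ.tilted fun ω => (-T) * Z ω)) - bm| ≤ ε)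
    (hgc : 2 * T * m ≤ |bp - bm|) :
    m - ε / T - κ * T ≤ |(∫ ω, W ω * Z ω ∂μ) - (∫ ω, W ω ∂μ) * (∫ ω, Z ω ∂μ)| := by
  let φ : ℝ → ℝ := fun t => ∫ ω, W ω ∂(μ.tilted fun ω => t * Z ω)
  let φ' : ℝ → ℝ := fun t => (∫ ω, W ω * Z ω ∂(μ.tilted fun ω => t * Z ω)) -
    (∫ ω, W ω ∂(μ.tilted fun ω => t * Z ω)) * (∫ ω, Z ω ∂(μ.tilted fun ω => t * Z ω))
  have hφ : ∀ t ∈ Set.Icc (-T) T, HasDerivAt φ (φ' t) t := fun t _ =>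
    SkewResponse.hasDerivAt_integral_tilted (μ := μ) hZ hW hZb hWb t
  have h0 : φ' 0 = (∫ ω, W ω * Z ω ∂μ) - (∫ ω, W ω ∂μ) * (∫ ω, Z ω ∂μ) := by
    show (∫ ω, W ω * Z ω ∂(μ.tilted fun ω => (0:ℝ) * Z ω)) -
      (∫ ω, W ω ∂(μ.tilted fun ω => (0:ℝ) * Z ω)) * (∫ ω, Z ω ∂(μ.tilted fun ω => (0:ℝ) * Z ω)) = _
    rw [SkewResponse.tilted_zero_mul]
  have hlip : ∀ t ∈ Set.Icc (-T) T, |φ' t - φ' 0| ≤ κ * |t| := fun t ht => by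
    rw [h0]; exact hK3C t ht
  have h := abs_deriv_ge_of_sandwich (φ := φ) (φ' := φ') hT hκ hφ hlip hp hm hgc
  rwa [h0] at h

end Response

/-! ## §4 The torus composition: (MS)+(GC)+(K3C) along the mirror-cube coupling modulation ⇒ (CR) ⇒ MF(4ε) -/

section Torus

open Literature.MathematicalPhysics.QuantumFieldTheory Literature.MathematicalPhysics.QuantumLattice
open Summit.QuantumFields.YangMills.Cruxes.OSLegsFromFemtoAndGap.DlrCollarTransfer
open Summit.QuantumFields.YangMills.Cruxes.NT.MarkovMirror (continuous_cfgReflect)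

variable (G : Type) [Group G] [TopologicalSpace G] [IsTopologicalGroup G] [CompactSpace G]
  [MeasurableSpace G] [BorelSpace G] (r : LatticeRep G)

/-- **(CR) on one torus from a sandwich of the coupling-modulated law.**  On the torus `2L+1` at coupling `β`, along
Wilson's measure TILTED by `t·(F∘Θ₀)∘lift` (`F` = the mirror-cube smeared density `Ṽ_v`: the coupling modulated by
`t·v` on the reflected cube), for bounded continuous `F, W`: the curvature ceiling (K3C)
`|Cov_t(W, F∘Θ₀) − Cov_0(W, F∘Θ₀)| ≤ κ|t|` on `[−T, T]`, sandwich outputs `|E_{±T}[W] − b_±| ≤ ε` for EXPLICIT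
numbers `b_±`, and the explicit increment `2Tm ≤ |b₊ − b₋|` give the unsigned conjugate response
`m − ε/T − κT ≤ |Cov_T(F∘Θ₀, W)| = |torusE(F∘Θ₀·W) − torusE F · torusE W|` — the `hCR` hypothesis of
`ConjugateResponse.mirrorFloor_of_abs_response` (p540130) and of `UVSeamRec.ConjugateResponseFloors` (p540929).
[folklore] -/
theorem abs_mirrorCov_ge_of_sandwich (β : ℝ) (L : ℕ) {F W : LGConfig 4 G → ℝ}
    (hFc : Continuous F) (hWc : Continuous W) {MF MW : ℝ} (hF : ∀ U, |F U| ≤ MF) (hW : ∀ U, |W U| ≤ MW)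
    {T κ m ε bp bm : ℝ} (hT : 0 < T) (hκ : 0 ≤ κ)
    (hK3C : ∀ t ∈ Set.Icc (-T) T,
      |((∫ U, W (torusLift (2 * L + 1) U) * F (cfgReflect (torusLift (2 * L + 1) U))
            ∂((wilsonMeasure (d := 4) (L := 2 * L + 1) r.ρ β).tilted
              fun U => t * F (cfgReflect (torusLift (2 * L + 1) U)))) -
          (∫ U, W (torusLift (2 * L + 1) U) ∂((wilsonMeasure (d := 4) (L := 2 * L + 1) r.ρ β).tilted
              fun U => t * F (cfgReflect (torusLift (2 * L + 1) U)))) *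
          (∫ U, F (cfgReflect (torusLift (2 * L + 1) U)) ∂((wilsonMeasure (d := 4) (L := 2 * L + 1) r.ρ β).tilted
              fun U => t * F (cfgReflect (torusLift (2 * L + 1) U))))) -
        (torusE G r β L (fun V => W V * F (cfgReflect V)) -
          torusE G r β L W * torusE G r β L (fun V => F (cfgReflect V)))| ≤ κ * |t|)
    (hp : |(∫ U, W (torusLift (2 * L + 1) U) ∂((wilsonMeasure (d := 4) (L := 2 * L + 1) r.ρ β).tilted
        fun U => T * F (cfgReflect (torusLift (2 * L + 1) U)))) - bp| ≤ ε)
    (hm : |(∫ U, W (torusLift (2 * L + 1) U) ∂((wilsonMeasure (d := 4) (L := 2 * L + 1) r.ρ β).tilted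
        fun U => (-T) * F (cfgReflect (torusLift (2 * L + 1) U)))) - bm| ≤ ε)
    (hgc : 2 * T * m ≤ |bp - bm|) :
    m - ε / T - κ * T ≤
      |torusE G r β L (fun V => F (cfgReflect V) * W V) - torusE G r β L F * torusE G r β L W| := by
  haveI := r.secondCountableTopology
  haveI := isProbabilityMeasure_wilsonMeasure (d := 4) (L := 2 * L + 1) r.ρ r.continuous β
  have hZm : Measurable fun U : GaugeConfig 4 (2 * L + 1) G => F (cfgReflect (torusLift (2 * L + 1) U)) :=
    ((hFc.comp continuous_cfgReflect).comp (continuous_torusLift _)).measurable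
  have hWm : Measurable fun U : GaugeConfig 4 (2 * L + 1) G => W (torusLift (2 * L + 1) U) :=
    (hWc.comp (continuous_torusLift _)).measurable
  have key := abs_cov_ge_of_sandwich (μ := wilsonMeasure (d := 4) (L := 2 * L + 1) r.ρ β) hZm hWm
    (fun U => hF _) (fun U => hW _) hT hκ (bp := bp) (bm := bm) (m := m) (ε := ε) ?_ hp hm hgc
  · -- `|Cov(W, F∘Θ₀)| = |Cov(F∘Θ₀, W)|`, and `E_T[F∘Θ₀] = E_T[F]`
    have e1 : torusE G r β L (fun V => F (cfgReflect V) * W V) = torusE G r β L (fun V => W V * F (cfgReflect V)) := by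
      congr 1; funext V; ring
    rw [e1, ← ConjugateResponse.torusE_comp_cfgReflect G r β L F]
    unfold torusE
    rw [mul_comm (∫ U, F (cfgReflect (torusLift (2 * L + 1) U)) ∂wilsonMeasure r.ρ β)]
    exact key
  · intro t ht
    have h := hK3C t ht
    unfold torusE at h
    exact h

end Torus

end Summit.QuantumFields.YangMills.Cruxes.NT.MeasureSandwich

end
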